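import Literature.NumberTheory.PAdicHodge.AinfAdicComplete
import HarnessLib

/-!
# `ℤ_p`-powers `x^a` in the tilt for `x ∈ 1 + p♭𝒪_{ℂ_F}♭` (`x₀ = 1`)

Topic `Literature/NumberTheory/PAdicHodge`; namespace `Literature.NumberTheory.PAdicHodge`. Definition (reviewed): `PreTilt.tiltPow x a`.
Generalises the tree's `epsPow a = ε^a` (`CyclotomicTilt`) from Fontaine's `ε` to every `x = (x_n)_n ∈ 𝒪_{ℂ_F}♭` with `x₀ = 1`
(equivalently `x♯ ≡ 1 (mod p)`, i.e. `x ∈ 1 + p♭𝒪♭`): then `x_n^{pⁿ} = x₀ = 1`, so `x_n^{m}` depends on `m mod pⁿ` only and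
`x^a := (x_n^{a mod pⁿ})_n` is a well-defined element of the tilt for every `a ∈ ℤ_p` — the `ℤ_p`-module structure of the multiplicative
group `1 + p♭𝒪♭` (Fontaine–Ouyang §6.1: `U⁺ ⊂ U = 1 + 𝔪_{ℂ♭}` is a `ℤ_p`-module, `U` a `ℚ_p`-vector space). API: `coeff_tiltPow`, `tiltPow_add`,
`tiltPow_zero`, `tiltPow_natCast` (`x^N = x^N`), `tiltPow_pow_mul` (`x^{p^m b} = (x^b)^{p^m}`), `coeff_zero_tiltPow` (`(x^a)₀ = 1`, so the
construction iterates), `tiltPow_mul_left` (`(xy)^a = x^a y^a`), `galTilt_tiltPow` (`σ♭(x^a) = (σ♭x)^a`), `epsPow_eq_tiltPow`; off `x₀ = 1` the junk value is `1`.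

Use: the `ℤ_p`-linear structure of Fontaine's `X = ℚ_p · log[1 + 𝔪♭] ⊂ B_dR⁺/Fil^k` (`a · log[x] = log[x^a]`, file `BdRPlusLogLatticeZp`),
floor (H4)-2 of `Summits/…/Cruxes/StarredOptimalManinUnitFiveSeven/Lines/kato-lever-K3-B2-road.md` (crux K★ `stmt-BirchSwinnertonDyer-22226`).
Infrastructure only; BSD / K★ are not proved by any of this.

## References
* J.-M. Fontaine, Y. Ouyang, *Theory of p-adic Galois representations*, §4.3, §6.1. [FontaineOuyang2022]
* J.-M. Fontaine, *Le corps des périodes p-adiques*, Astérisque 223 (1994), Exp. II §1.2.2. [FontaineAsterisque223III]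
-/

noncomputable section

open ValuativeRel Field UniformSpace

namespace Literature.NumberTheory.PAdicHodge

open Literature.NumberTheory.GaloisRepresentations
open Literature.NumberTheory.GaloisRepresentations.IsNonarchimedeanLocalField

variable {F : Type} [Field F] [ValuativeRel F] [TopologicalSpace F] [IsNonarchimedeanLocalField F]
  [CharZero F] {p : ℕ} [Fact p.Prime] [Fact (¬ IsUnit (p : integerC F))]

omit [CharZero F] in
/-- For `x₀ = 1`: `x_n^{pⁿ} = 1`. [cite: FontaineOuyang2022, §4.3] -/
theorem PreTilt.coeff_pow_prime_pow_eq_one {x : PreTilt (integerC F) p} (hx : PreTilt.coeff 0 x = 1) (n : ℕ) :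
    PreTilt.coeff n x ^ p ^ n = 1 := by
  rw [PreTiltComplete.coeff_pow_prime_pow, hx]

open scoped Classical in
/-- **`x^a ∈ 𝒪_{ℂ_F}♭` for `a ∈ ℤ_p` and `x₀ = 1`**: componentwise `x_n^{a mod pⁿ}` (well defined since `x_n^{pⁿ} = x₀ = 1`); junk value `1`
when `x₀ ≠ 1`. [cite: FontaineOuyang2022, §6.1] -/
def PreTilt.tiltPow (x : PreTilt (integerC F) p) (a : ℤ_[p]) : PreTilt (integerC F) p :=
  if hx : PreTilt.coeff 0 x = 1 then
    ⟨fun n => PreTilt.coeff n x ^ (PadicInt.toZModPow n a).val, fun n => by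
      rw [← pow_mul, mul_comm, pow_mul, PreTilt.coeff_pow_p,
        pow_eq_pow_of_modEq (PreTilt.coeff_pow_prime_pow_eq_one hx n) (toZModPow_val_modEq a (Nat.le_succ n))]⟩
  else 1

namespace PreTilt

omit [CharZero F] in
/-- Coefficients of `x^a`: `(x^a)_n = x_n^{a mod pⁿ}` (`x₀ = 1`). [cite: FontaineOuyang2022, §6.1] -/
@[simp] theorem coeff_tiltPow {x : PreTilt (integerC F) p} (hx : PreTilt.coeff 0 x = 1) (a : ℤ_[p]) (n : ℕ) :
    PreTilt.coeff n (tiltPow x a) = PreTilt.coeff n x ^ (PadicInt.toZModPow n a).val := by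
  rw [tiltPow, dif_pos hx]; rfl

omit [CharZero F] in
/-- The junk value: `x^a = 1` when `x₀ ≠ 1`. [cite: FontaineOuyang2022, §6.1] -/
theorem tiltPow_of_coeff_zero_ne_one {x : PreTilt (integerC F) p} (hx : PreTilt.coeff 0 x ≠ 1) (a : ℤ_[p]) : tiltPow x a = 1 := by
  rw [tiltPow, dif_neg hx]

omit [CharZero F] in
/-- `(x^a)₀ = 1`: `x^a` is again in `1 + p♭𝒪♭`, so the construction iterates. [cite: FontaineOuyang2022, §6.1] -/
theorem coeff_zero_tiltPow (x : PreTilt (integerC F) p) (a : ℤ_[p]) : PreTilt.coeff 0 (tiltPow x a) = 1 := by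
  by_cases hx : PreTilt.coeff 0 x = 1
  · rw [coeff_tiltPow hx, hx, one_pow]
  · rw [tiltPow_of_coeff_zero_ne_one hx, map_one]

omit [CharZero F] in
/-- `x^(a+b) = x^a x^b`. [cite: FontaineOuyang2022, §6.1] -/
theorem tiltPow_add (x : PreTilt (integerC F) p) (a b : ℤ_[p]) : tiltPow x (a + b) = tiltPow x a * tiltPow x b := by
  by_cases hx : PreTilt.coeff 0 x = 1
  · refine Perfection.ext fun n => ?_
    haveI : NeZero (p ^ n) := ⟨pow_ne_zero _ (Fact.out : p.Prime).ne_zero⟩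
    change PreTilt.coeff n (tiltPow x (a + b)) = PreTilt.coeff n (tiltPow x a * tiltPow x b)
    rw [map_mul, coeff_tiltPow hx, coeff_tiltPow hx, coeff_tiltPow hx, ← pow_add, map_add, ZMod.val_add,
      ← pow_eq_pow_mod_of_pow_eq_one (coeff_pow_prime_pow_eq_one hx n)]
  · rw [tiltPow_of_coeff_zero_ne_one hx, tiltPow_of_coeff_zero_ne_one hx, tiltPow_of_coeff_zero_ne_one hx, mul_one]

omit [CharZero F] in
/-- `x^0 = 1`. [cite: FontaineOuyang2022, §6.1] -/
theorem tiltPow_zero (x : PreTilt (integerC F) p) : tiltPow x 0 = 1 := by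
  by_cases hx : PreTilt.coeff 0 x = 1
  · refine Perfection.ext fun n => ?_
    change PreTilt.coeff n (tiltPow x 0) = PreTilt.coeff n 1
    rw [coeff_tiltPow hx, map_zero, ZMod.val_zero, pow_zero, map_one]
  · exact tiltPow_of_coeff_zero_ne_one hx 0

omit [CharZero F] in
/-- `x^(-a) · x^a = 1`: `x^a` is a unit with inverse `x^{−a}`. [cite: FontaineOuyang2022, §6.1] -/
theorem tiltPow_neg_mul_tiltPow (x : PreTilt (integerC F) p) (a : ℤ_[p]) : tiltPow x (-a) * tiltPow x a = 1 := by
  rw [← tiltPow_add, neg_add_cancel, tiltPow_zero]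

omit [CharZero F] in
/-- **`x^N = x^N` for `N : ℕ`** (`x₀ = 1`): `tiltPow` extends the monoid powers. [cite: FontaineOuyang2022, §6.1] -/
theorem tiltPow_natCast {x : PreTilt (integerC F) p} (hx : PreTilt.coeff 0 x = 1) (N : ℕ) : tiltPow x (N : ℤ_[p]) = x ^ N := by
  refine Perfection.ext fun n => ?_
  change PreTilt.coeff n (tiltPow x (N : ℤ_[p])) = PreTilt.coeff n (x ^ N)
  rw [map_pow, coeff_tiltPow hx, map_natCast, ZMod.val_natCast, ← pow_eq_pow_mod_of_pow_eq_one (coeff_pow_prime_pow_eq_one hx n)]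

omit [CharZero F] in
/-- `x^1 = x` (`x₀ = 1`). [cite: FontaineOuyang2022, §6.1] -/
theorem tiltPow_one {x : PreTilt (integerC F) p} (hx : PreTilt.coeff 0 x = 1) : tiltPow x 1 = x := by
  have h := tiltPow_natCast hx 1
  rwa [Nat.cast_one, pow_one] at h

omit [CharZero F] in
/-- **`x^(pᵐ b) = (x^b)^(pᵐ)`.** [cite: FontaineOuyang2022, §6.1] -/
theorem tiltPow_pow_mul (x : PreTilt (integerC F) p) (m : ℕ) (b : ℤ_[p]) :
    tiltPow x ((p : ℤ_[p]) ^ m * b) = tiltPow x b ^ p ^ m := by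
  by_cases hx : PreTilt.coeff 0 x = 1
  · refine Perfection.ext fun n => ?_
    haveI : NeZero (p ^ n) := ⟨pow_ne_zero _ (Fact.out : p.Prime).ne_zero⟩
    change PreTilt.coeff n (tiltPow x ((p : ℤ_[p]) ^ m * b)) = PreTilt.coeff n (tiltPow x b ^ p ^ m)
    rw [map_pow, coeff_tiltPow hx, coeff_tiltPow hx, ← pow_mul]
    refine pow_eq_pow_of_modEq (coeff_pow_prime_pow_eq_one hx n) ?_
    rw [map_mul, ZMod.val_mul, map_pow, map_natCast, ← Nat.cast_pow, ZMod.val_natCast]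
    refine (Nat.mod_modEq _ _).trans (((Nat.mod_modEq _ _).mul_right _).trans ?_)
    rw [mul_comm]
  · rw [tiltPow_of_coeff_zero_ne_one hx, tiltPow_of_coeff_zero_ne_one hx, one_pow]

omit [CharZero F] in
/-- `x^a = x^{a mod p^N} · (x^b)^{p^N}` whenever `a = (a mod p^N) + p^N b` — the shape used for `p`-adic approximation (`x₀ = 1`).
[cite: FontaineOuyang2022, §6.1] -/
theorem tiltPow_eq_pow_mul_pow {x : PreTilt (integerC F) p} (hx : PreTilt.coeff 0 x = 1) {a b : ℤ_[p]} {N v : ℕ}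
    (h : a = (v : ℤ_[p]) + (p : ℤ_[p]) ^ N * b) : tiltPow x a = x ^ v * tiltPow x b ^ p ^ N := by
  rw [h, tiltPow_add, tiltPow_natCast hx, tiltPow_pow_mul]

omit [CharZero F] in
/-- **`(xy)^a = x^a y^a`** (`x₀ = y₀ = 1`). [cite: FontaineOuyang2022, §6.1] -/
theorem tiltPow_mul_left {x y : PreTilt (integerC F) p} (hx : PreTilt.coeff 0 x = 1) (hy : PreTilt.coeff 0 y = 1) (a : ℤ_[p]) :
    tiltPow (x * y) a = tiltPow x a * tiltPow y a := by
  have hxy : PreTilt.coeff 0 (x * y) = 1 := by rw [map_mul, hx, hy, mul_one]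
  refine Perfection.ext fun n => ?_
  change PreTilt.coeff n (tiltPow (x * y) a) = PreTilt.coeff n (tiltPow x a * tiltPow y a)
  rw [map_mul, coeff_tiltPow hxy, coeff_tiltPow hx, coeff_tiltPow hy, map_mul, mul_pow]

/-- **`ε^a` is `tiltPow ε a`**: the tree's `epsPow` is the special case `x = ε` (`ε₀ = 1`). [cite: FontaineOuyang2022, §5.1.2] -/
theorem epsPow_eq_tiltPow (a : ℤ_[p]) : (epsPow a : PreTilt (integerC F) p) = tiltPow eps a := by
  have h0 : PreTilt.coeff 0 (eps : PreTilt (integerC F) p) = 1 := by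
    rw [coeff_eps, epsC_zero, map_one]
  refine Perfection.ext fun n => ?_
  change PreTilt.coeff n (epsPow a) = PreTilt.coeff n (tiltPow eps a)
  rw [coeff_epsPow, coeff_tiltPow h0, coeff_eps, map_pow]

omit [CharZero F] in
/-- **Galois equivariance `σ♭(x^a) = (σ♭ x)^a`** (`σ♭` acts componentwise by ring maps). [cite: FontaineOuyang2022, §6.1] -/
theorem galTilt_tiltPow (σ : absoluteGaloisGroup F) (x : PreTilt (integerC F) p) (a : ℤ_[p]) :
    galTilt σ (tiltPow x a) = tiltPow (galTilt σ x) a := by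
  by_cases hx : PreTilt.coeff 0 x = 1
  · have hσx : PreTilt.coeff 0 (galTilt σ x) = 1 := by rw [coeff_galTilt, hx, map_one]
    refine Perfection.ext fun n => ?_
    change PreTilt.coeff n (galTilt σ (tiltPow x a)) = PreTilt.coeff n (tiltPow (galTilt σ x) a)
    rw [coeff_galTilt, coeff_tiltPow hx, coeff_tiltPow hσx, coeff_galTilt, map_pow]
  · have hσx : PreTilt.coeff 0 (galTilt σ x) ≠ 1 := by
      intro h
      apply hx
      have h1 := congrArg (galModP (p := p) σ⁻¹) h
      rwa [coeff_galTilt, ← galModP_mul, inv_mul_cancel, galModP_one, map_one] at h1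
    rw [tiltPow_of_coeff_zero_ne_one hx, tiltPow_of_coeff_zero_ne_one hσx, map_one]

end PreTilt

end Literature.NumberTheory.PAdicHodge

end
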